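import Summits.QuantumFields.YangMills.Theorems.BalabanUVNodesN12FlatLinAvgRightInverseUniform
import Summits.QuantumFields.YangMills.Theorems.UnitScaleTiltProp8ChartHInvComb
import HarnessLib

/-!
# BalabanUVNodes ∕ N12 — (J-b) module H13: A RIGHT INVERSE OF THE TRUE `k`-FOLD LINEARISATION `Q^{(k)} = L^k·Q_k − dΛ_k` WITH A `k`-, `L`- AND VOLUME-UNIFORM LETTER (top level, whole torus, flat) —
# `Σ_b ‖(R v)(b)‖² ≤ |n|·(6M^d∕(M²+2) + 1152·d(d+2)²)·Σ_c ‖v(c)‖²`, `M = L^k`; in print's η-units (weight `M^{d−2}`, `d ≥ 2`) `ρ² ≤ |n|(6 + 1152d(d+2)²)`: [Balaban1985Variational] (46) at the top level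

Cell `pub-ymgap` (HUMAN RULINGS D-0062 ∕ D-0149), width seat `pub-ymgap-dag-n10-w1` g5 (modules H8–H12d of this session; this is rung R6 of HOME `pub-ymgap-dag-n10-w1/EXIT-B-LADDER-g5.md`, designed in
`H13-DESIGN.md`).  `--kind proof --supports stmt-QuantumFields-27364 --as helper` (K1⁹, KEY MAP v2); count-neutral; THEOREMS ONLY (0 `def`, 0 `sorry`, 0 `instance`, 0 `notation`).

THE DEVICE (= H12a∕H12b one level up in bookkeeping).  For UST's families `Q` (`Q 0 = id`, `Q (i+1) = linAvg ∘ Q i`) and `Λ` (`Λ 0 = 0`, `Λ (i+1) Y y = L^i•λ̄(Q_iY)(y) + Λ i Y (emb y)`):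
`Q k Y = (L^k:ℕ)•Q_kY − dΛ_k(Y)` (`linFamily_eq_sub_comb`) and `Q k (dψ) = d(ψ∘embIter k)` (`linFamily_grad`).  `Y₀ :=` the entrywise k-fold TENT right inverse of `L^k•Q_k` (module H11 §2):
`Σ‖Y₀‖² ≤ |n|·3M^d∕(M²+2)·Σ‖v‖²`, pointwise `‖Y₀ b‖² ≤ 2M^{−2d}T(y)` on the k-block `y` of `b₋`, `Σ_y T(y) ≤ 2M⁻²c₀⁻²|n|Σ‖v‖²`.  SPIKES `ψ = Λ k Y₀ (y)` at the level-0 centres `embIter k y`: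
`Y := Y₀ + dψ` solves `Q k Y = v` at cost `2Σ‖Y₀‖² + 8dΣ_y ‖Λ k Y₀ y‖²` (H12a's `sum_norm_sq_grad_le` + one centre per k-block).  THE COMB IS LOCAL AND SUP-BOUNDED (UST, unit-scale-tilt's
`ChartHInv.norm_combFamily_le_of_local`): `‖Λ k Y y‖ ≤ (d+2)L·(Σ_{i<k}L^i)·a ≤ 2(d+2)L^k·a` whenever `‖Y b‖ ≤ a` on the fine bonds inside the k-block of `y` (`mul_sum_range_pow_le`; the crude
`Σ_{i<k}L^i ≤ L^k` would cost a factor `L²` in the letter).  Hence `Σ_y‖Λ k Y₀ y‖² ≤ 8(d+2)²M²·M^{−2d}Σ_yT(y) ≤ 16(d+2)²·(M^{4}∕(M²+2)²·9 ≤ 9)·|n|Σ‖v‖²`.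

CONTENTS (ns `Summit.QuantumFields.YangMills.BalabanUVNodes.N12FlatLinFamilyRightInverseUniform`).  §1 `mul_sum_range_pow_le`, `sum_norm_sq_spike_iter_eq`; §2 `re_bondAvgIter_entry`, `im_bondAvgIter_entry`,
`bondAvgIter_mem_lieSU'`, `combFamily_mem_lieSU'`, ★★★ `exists_linFamily_rightInverse_uniform`.

HONEST FRAMING.  Linear algebra + lattice bookkeeping at the FLAT configuration on the tree's own averaging; TOP level only (one `k`, whole torus), constants polynomial in `d`, `|n|` (not optimised);
the multi-level ∕ reading-(b) ∕ regional right inverse of print's (44)–(46) (J-C's `ρc` at `Bj M₁ Z k`) stays OPEN and crux-sized; nothing of Bałaban's asserted beyond this count; N12 ∕ N10 NOT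
discharged; K1⁹ NOT closed; count-neutral (typed 28∕28 · discharged 5∕27 unmoved); one finite 𝕋⁴ programme at fixed ε — R4 closes the conditional finite-𝕋⁴ rung `BalabanLadder.UV` only; the YM
mass gap (Clay) is NOT proved by any of this; nothing continuum ∕ ℝ⁴ ∕ OS.
-/

noncomputable section
open scoped BigOperators Matrix.Norms.L2Operator
open Finset
namespace Summit.QuantumFields.YangMills.BalabanUVNodes.N12FlatLinFamilyRightInverseUniform

open Literature.MathematicalPhysics.QuantumFieldTheory.Balaban1983to89
open LatticeFieldCalculus (bondAvg bondAvgIter)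
open BlockAveragingEMLLinearised (linAvg combMean)
open B5Eq118OneStroke (iterBlock iterBlockOf mem_iterBlock)
open B15DeterminingSets (embIter)
open Literature.MathematicalPhysics.QuantumFieldTheory.BalabanImbrieJaffe1984to88.BIJ88RT51Background (iterBlockOf_embIter)
open T4AdjointCovarianceUnitary (lieSU)
open Summit.QuantumFields.YangMills.Theorems.ChartHInv (bondAvgIter_comp_apply norm_combFamily_le_of_local exists_combFamily linFamily_add linFamily_grad linFamily_eq_sub_comb
  combFamily_add combFamily_const_smul)
open Summit.QuantumFields.YangMills.BalabanUVNodes.N12FlatIterGramExact (sum_site_eq_sum_iterBlock)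
open Summit.QuantumFields.YangMills.BalabanUVNodes.N12FlatGramInverseTent (exists_tent_rightInverse_smul_bondAvgIter)
open Summit.QuantumFields.YangMills.BalabanUVNodes.N12FlatLinAvgCombCorrection (sum_norm_sq_grad_le)
open Summit.QuantumFields.YangMills.BalabanUVNodes.N12FlatLinAvgRightInverseUniform (norm_sq_le_sum_re_sq_add_im_sq sum_norm_entry_sq_le norm_entry_sq_eq combMean_mem_lieSU')

variable {P : Params} {n : Type*} [Fintype n] [DecidableEq n]

/-! ## §1  Two bookkeeping identities -/

/-- `L·Σ_{i<k} L^i ≤ 2·L^k` for `L ≥ 2` (the sharp form of UST's `sum_range_pow_le`, which keeps the letter `L`-uniform). [folklore] -/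
theorem mul_sum_range_pow_le (k : ℕ) : (P.L : ℝ) * ∑ i ∈ Finset.range k, (P.L : ℝ) ^ i ≤ 2 * (P.L : ℝ) ^ k := by
  have hL2 : (2 : ℝ) ≤ (P.L : ℝ) := by exact_mod_cast P.hL.2
  induction k with
  | zero => simp
  | succ k ih =>
    rw [Finset.sum_range_succ, mul_add, pow_succ]
    nlinarith [ih, pow_nonneg (by linarith : (0:ℝ) ≤ (P.L : ℝ)) k]


/-- `Σ_x ‖ψ(x)‖² = Σ_y ‖Λ(y)‖²` for the spikes `ψ(x) = Λ(iterBlockOf k x)` at the centres `x = embIter k (iterBlockOf k x)`, `0` elsewhere (`k ≤ m + K`). [cite: Balaban1987RG1, (0.1) p.251] -/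
theorem sum_norm_sq_spike_iter_eq {k : ℕ} (hk : k ≤ P.m + P.K) (Λ : Site P k → Matrix n n ℂ) :
    ∑ x : Site P 0, ‖(if x = embIter k (iterBlockOf k x) then Λ (iterBlockOf k x) else 0)‖ ^ 2 = ∑ y : Site P k, ‖Λ y‖ ^ 2 := by
  rw [sum_site_eq_sum_iterBlock (k := k)]
  refine Finset.sum_congr rfl fun y _ => ?_
  have hn : ∀ (p : Prop) [Decidable p] (A : Matrix n n ℂ), ‖(if p then A else (0 : Matrix n n ℂ))‖ ^ 2 = if p then ‖A‖ ^ 2 else 0 := by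
    intro p _ A; split_ifs <;> simp
  simp only [hn]
  rw [Finset.sum_eq_single_of_mem (embIter k y) ((mem_iterBlock k y _).2 (iterBlockOf_embIter k hk y))]
  · rw [iterBlockOf_embIter k hk y, if_pos rfl]
  · intro x hx hne
    have hx' : iterBlockOf k x = y := (mem_iterBlock k y x).1 hx
    rw [hx', if_neg hne]

/-! ## §2  The uniform right inverse of the true `k`-fold linearisation -/

omit [Fintype n] [DecidableEq n] in
/-- The straight `k`-fold average acts ENTRYWISE (real part). [cite: Balaban1984PropagatorsI, (1.18) p.20] -/
theorem re_bondAvgIter_entry (k : ℕ) (Y : PBond P 0 → Matrix n n ℂ) (c : PBond P k) (i i' : n) :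
    (bondAvgIter k Y c i i').re = bondAvgIter k (fun b => (Y b i i').re) c := by
  have h := bondAvgIter_comp_apply (Complex.reLm ∘ₗ Matrix.entryLinearMap ℝ ℂ i i') k Y c
  simp only [LinearMap.coe_comp, Function.comp_apply, Matrix.entryLinearMap_apply, Complex.reLm_coe] at h
  exact h.symm

omit [Fintype n] [DecidableEq n] in
/-- The straight `k`-fold average acts ENTRYWISE (imaginary part). [cite: Balaban1984PropagatorsI, (1.18) p.20] -/
theorem im_bondAvgIter_entry (k : ℕ) (Y : PBond P 0 → Matrix n n ℂ) (c : PBond P k) (i i' : n) :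
    (bondAvgIter k Y c i i').im = bondAvgIter k (fun b => (Y b i i').im) c := by
  have h := bondAvgIter_comp_apply (Complex.imLm ∘ₗ Matrix.entryLinearMap ℝ ℂ i i') k Y c
  simp only [LinearMap.coe_comp, Function.comp_apply, Matrix.entryLinearMap_apply, Complex.imLm_coe] at h
  exact h.symm

omit [DecidableEq n] in
/-- `Q_k` of an `𝔰𝔲`-valued field is `𝔰𝔲`-valued (`Q_k` on the real module `𝔰𝔲` read back in matrices; k0-s1's `bondAvgIter_mem_lieSU` for a general index type). [cite: Balaban1984PropagatorsI, (1.18) p.20] -/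
theorem bondAvgIter_mem_lieSU' (k : ℕ) {Y : PBond P 0 → Matrix n n ℂ} (hY : ∀ b, Y b ∈ lieSU n) (c : PBond P k) : bondAvgIter k Y c ∈ lieSU n := by
  have h := bondAvgIter_comp_apply (lieSU n).subtype k (fun b => (⟨Y b, hY b⟩ : lieSU n)) c
  simp only [Submodule.subtype_apply] at h
  rw [h]
  exact (bondAvgIter k (fun b => (⟨Y b, hY b⟩ : lieSU n)) c).2

omit [DecidableEq n] in
/-- The hierarchical comb functional `Λ_k` of an `𝔰𝔲`-valued field is `𝔰𝔲`-valued (k0-s1's `combFamily_mem_lieSU` for a general index type). [cite: Balaban1985Averaging, (62) p.28] -/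
theorem combFamily_mem_lieSU' (Λ : (i : ℕ) → (PBond P 0 → Matrix n n ℂ) → Site P i → Matrix n n ℂ) (hΛ0 : ∀ Y y, Λ 0 Y y = 0)
    (hΛs : ∀ (i : ℕ) (Y : PBond P 0 → Matrix n n ℂ) (y : Site P (i + 1)), Λ (i + 1) Y y = (P.L ^ i : ℕ) • combMean (bondAvgIter i Y) y + Λ i Y (emb y))
    {Y : PBond P 0 → Matrix n n ℂ} (hY : ∀ b, Y b ∈ lieSU n) : ∀ (k : ℕ) (y : Site P k), Λ k Y y ∈ lieSU n
  | 0, y => by rw [hΛ0]; exact Submodule.zero_mem _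
  | k + 1, y => by
    rw [hΛs]
    exact Submodule.add_mem _ (nsmul_mem (combMean_mem_lieSU' (fun b => bondAvgIter_mem_lieSU' k hY b) y) _) (combFamily_mem_lieSU' Λ hΛ0 hΛs hY k (emb y))

/-- ★★★ **A RIGHT INVERSE OF THE TRUE `k`-FOLD LINEARISATION WITH A `k`-, `L`- AND VOLUME-UNIFORM LETTER** (`k ≤ m + K`, `M = L^k`): for every `linAvg`-family `Q` there is `R` — additive,
ℝ-homogeneous, `𝔰𝔲`-preserving — with `Q k (R v) = v` and
`Σ_b ‖(R v)(b)‖² ≤ |n|·(6M^d∕(M²+2) + 1152·d·(d+2)²)·Σ_c ‖v(c)‖²` — in η-units (weight `M^{d−2}`, `d ≥ 2`) `ρ² ≤ |n|(6 + 1152d(d+2)²)`, the same for every `k`.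
[cite: Balaban1985Variational, (44)-(46) p.285; Balaban1985Averaging, (124)-(125) p.36, (62) p.28; Balaban1984PropagatorsI, (1.18) p.20] -/
theorem exists_linFamily_rightInverse_uniform
    (Q : (i : ℕ) → (PBond P 0 → Matrix n n ℂ) → PBond P i → Matrix n n ℂ)
    (hQ0 : ∀ Y, Q 0 Y = Y) (hQs : ∀ (i : ℕ) (Y : PBond P 0 → Matrix n n ℂ) (c : PBond P (i + 1)), Q (i + 1) Y c = linAvg (Q i Y) c)
    {k : ℕ} (hk : k ≤ P.m + P.K) :
    ∃ R : (PBond P k → Matrix n n ℂ) → (PBond P 0 → Matrix n n ℂ),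
      (∀ v c, Q k (R v) c = v c) ∧
      (∀ v w, R (v + w) = R v + R w) ∧ (∀ (a : ℝ) v, R (a • v) = a • R v) ∧
      (∀ v, (∀ c, v c ∈ lieSU n) → ∀ b, R v b ∈ lieSU n) ∧
      ∀ v, ∑ b, ‖R v b‖ ^ 2 ≤ Fintype.card n * (6 * (((P.L ^ k : ℕ) : ℝ)) ^ P.d / ((((P.L ^ k : ℕ) : ℝ)) ^ 2 + 2) + 1152 * P.d * ((P.d : ℝ) + 2) ^ 2) *
        ∑ c, ‖v c‖ ^ 2 := by
  classical
  obtain ⟨Λ, hΛ0, hΛs⟩ := exists_combFamily (P := P) (n := n)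
  have hMpos : (0 : ℝ) < ((P.L ^ k : ℕ) : ℝ) := by have := P.L_pos; positivity
  have hM' : ((P.L ^ k : ℕ) : ℝ) ≠ 0 := hMpos.ne'
  have hLk : (P.L : ℝ) ^ k = ((P.L ^ k : ℕ) : ℝ) := by push_cast; ring
  obtain ⟨G', hG'le, hG'id, hH'le, hpt⟩ := exists_tent_rightInverse_smul_bondAvgIter (P := P) hk
  -- the real k-fold tent inverse and its properties
  set Hr : (PBond P k → ℝ) → PBond P 0 → ℝ := fun w b => ∑ c, bondAvgIter k (Pi.single b (1 : ℝ)) c * G' w c with hHr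
  have hF1 : ∀ (w : PBond P k → ℝ) (c : PBond P k), ((P.L ^ k : ℕ) : ℝ) * bondAvgIter k (Hr w) c = w c := fun w c => by
    have := congrFun (hG'id w) c
    rw [hLk] at this
    simpa [Pi.smul_apply, smul_eq_mul] using this
  have hF2 : ∀ w : PBond P k → ℝ, ∑ b, (Hr w b) ^ 2 ≤ (3 * (((P.L ^ k : ℕ) : ℝ)) ^ P.d / ((((P.L ^ k : ℕ) : ℝ)) ^ 2 + 2)) * ∑ c, (w c) ^ 2 := fun w => hH'le w
  have hF3 : ∀ (w : PBond P k → ℝ) (b : PBond P 0),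
      (Hr w b) ^ 2 ≤ 2 * ((((P.L ^ k : ℕ) : ℝ)) ^ P.d)⁻¹ ^ 2 * ((G' w ⟨iterBlockOf k b.src, b.dir⟩) ^ 2 + (G' w ⟨(iterBlockOf k b.src).unshift b.dir, b.dir⟩) ^ 2) := by
    intro w b
    have h1 : |Hr w b| ≤ ((((P.L ^ k : ℕ) : ℝ)) ^ P.d)⁻¹ * (|G' w ⟨iterBlockOf k b.src, b.dir⟩| + |G' w ⟨(iterBlockOf k b.src).unshift b.dir, b.dir⟩|) := by
      have := hpt w b.src b.dir; cases b; exact this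
    have h2 : (Hr w b) ^ 2 ≤ (((((P.L ^ k : ℕ) : ℝ)) ^ P.d)⁻¹ * (|G' w ⟨iterBlockOf k b.src, b.dir⟩| + |G' w ⟨(iterBlockOf k b.src).unshift b.dir, b.dir⟩|)) ^ 2 := by
      rw [← sq_abs (Hr w b)]; exact pow_le_pow_left₀ (abs_nonneg _) h1 2
    have h3 : (|G' w ⟨iterBlockOf k b.src, b.dir⟩| + |G' w ⟨(iterBlockOf k b.src).unshift b.dir, b.dir⟩|) ^ 2 ≤
        2 * ((G' w ⟨iterBlockOf k b.src, b.dir⟩) ^ 2 + (G' w ⟨(iterBlockOf k b.src).unshift b.dir, b.dir⟩) ^ 2) := by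
      rw [← sq_abs (G' w ⟨iterBlockOf k b.src, b.dir⟩), ← sq_abs (G' w ⟨(iterBlockOf k b.src).unshift b.dir, b.dir⟩)]
      nlinarith [sq_nonneg (|G' w ⟨iterBlockOf k b.src, b.dir⟩| - |G' w ⟨(iterBlockOf k b.src).unshift b.dir, b.dir⟩|)]
    refine h2.trans ?_
    rw [mul_pow]; nlinarith [h3, sq_nonneg (((((P.L ^ k : ℕ) : ℝ)) ^ P.d)⁻¹)]
  -- `Hr` as a real-linear map
  let HrL : (PBond P k → ℝ) →ₗ[ℝ] (PBond P 0 → ℝ) :=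
    { toFun := Hr
      map_add' := fun w w' => funext fun b => by
        simp only [hHr, map_add, Pi.add_apply, mul_add, Finset.sum_add_distrib]
      map_smul' := fun a w => funext fun b => by
        simp only [hHr, map_smul, Pi.smul_apply, smul_eq_mul, RingHom.id_apply, Finset.mul_sum, mul_left_comm] }
  have hHrL : ∀ w, HrL w = Hr w := fun _ => rfl
  have hHr_sum : ∀ (f : n → PBond P k → ℝ) b, Hr (∑ i, f i) b = ∑ i, Hr (f i) b := fun f b => by rw [← hHrL, map_sum, Finset.sum_apply]; rfl
  have hHr_add : ∀ w w' b, Hr (w + w') b = Hr w b + Hr w' b := fun w w' b => by rw [← hHrL, map_add]; rfl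
  have hHr_smul : ∀ (a : ℝ) w b, Hr (a • w) b = a * Hr w b := fun a w b => by rw [← hHrL, map_smul]; rfl
  have hHr_neg : ∀ w b, Hr (-w) b = -Hr w b := fun w b => by rw [← hHrL, map_neg]; rfl
  have hHr_zero : ∀ b, Hr 0 b = 0 := fun b => by rw [← hHrL, map_zero]; rfl
  -- the matrix-valued straight inverse
  set Y₀ : (PBond P k → Matrix n n ℂ) → PBond P 0 → Matrix n n ℂ := fun v b =>
    Matrix.of fun i i' => (⟨Hr (fun c => (v c i i').re) b, Hr (fun c => (v c i i').im) b⟩ : ℂ) with hY₀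
  have hY₀re : ∀ v b i i', (Y₀ v b i i').re = Hr (fun c => (v c i i').re) b := fun _ _ _ _ => rfl
  have hY₀im : ∀ v b i i', (Y₀ v b i i').im = Hr (fun c => (v c i i').im) b := fun _ _ _ _ => rfl
  have hstraight : ∀ v (c : PBond P k), (P.L ^ k : ℕ) • bondAvgIter k (Y₀ v) c = v c := by
    intro v c
    rw [← Nat.cast_smul_eq_nsmul ℂ]
    ext i i'
    rw [Matrix.smul_apply, smul_eq_mul]
    apply Complex.ext
    · rw [Complex.mul_re, Complex.natCast_re, Complex.natCast_im, zero_mul, sub_zero, re_bondAvgIter_entry]; simp only [hY₀re]; exact hF1 _ c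
    · rw [Complex.mul_im, Complex.natCast_re, Complex.natCast_im, zero_mul, add_zero, im_bondAvgIter_entry]; simp only [hY₀im]; exact hF1 _ c
  -- linearity and `𝔰𝔲`-preservation of `Y₀` (entrywise)
  have hY₀_add : ∀ v w, Y₀ (v + w) = fun b => Y₀ v b + Y₀ w b := by
    intro v w; funext b; ext i i'
    apply Complex.ext
    · rw [Matrix.add_apply, Complex.add_re, hY₀re, hY₀re, hY₀re, ← hHr_add]; rfl
    · rw [Matrix.add_apply, Complex.add_im, hY₀im, hY₀im, hY₀im, ← hHr_add]; rfl
  have hY₀_smul : ∀ (a : ℝ) v, Y₀ (a • v) = fun b => a • Y₀ v b := by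
    intro a v; funext b; ext i i'
    apply Complex.ext
    · rw [Matrix.smul_apply, Complex.smul_re, smul_eq_mul, hY₀re, hY₀re, ← hHr_smul]
      congr 1; funext c; simp only [Pi.smul_apply, Matrix.smul_apply, Complex.smul_re, smul_eq_mul]
    · rw [Matrix.smul_apply, Complex.smul_im, smul_eq_mul, hY₀im, hY₀im, ← hHr_smul]
      congr 1; funext c; simp only [Pi.smul_apply, Matrix.smul_apply, Complex.smul_im, smul_eq_mul]
  have hY₀_su : ∀ v, (∀ c, v c ∈ lieSU n) → ∀ b, Y₀ v b ∈ lieSU n := by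
    intro v hv b
    rw [T4AdjointCovarianceUnitary.mem_lieSU_iff]
    refine ⟨?_, ?_⟩
    · ext i i'
      rw [Matrix.star_apply, Matrix.neg_apply]
      have hst : ∀ c, star (v c i' i) = -(v c i i') := fun c => by
        have h := congrFun (congrFun (T4AdjointCovarianceUnitary.mem_lieSU_iff.1 (hv c)).1 i) i'; rwa [Matrix.star_apply, Matrix.neg_apply] at h
      have hre : (fun c => (v c i' i).re) = -fun c => (v c i i').re := by
        funext c; have := congrArg Complex.re (hst c); simpa using this
      have him : (fun c => (v c i' i).im) = fun c => (v c i i').im := by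
        funext c; have := congrArg Complex.im (hst c); simp only [Complex.star_def, Complex.conj_im, Complex.neg_im] at this; linarith
      apply Complex.ext
      · simp only [Complex.star_def, Complex.conj_re, Complex.neg_re, hY₀re, hre, hHr_neg]
      · simp only [Complex.star_def, Complex.conj_im, Complex.neg_im, hY₀im, him]
    · rw [Matrix.trace]
      have htr : ∀ c, ∑ i, v c i i = 0 := fun c => (T4AdjointCovarianceUnitary.mem_lieSU_iff.1 (hv c)).2
      apply Complex.ext
      · rw [Complex.re_sum, Complex.zero_re]
        simp only [Matrix.diag_apply, hY₀re]
        rw [← hHr_sum]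
        have h0 : (∑ i, fun c => (v c i i).re) = 0 := by
          funext c; rw [Finset.sum_apply, Pi.zero_apply, ← Complex.re_sum, htr c, Complex.zero_re]
        rw [h0, hHr_zero]
      · rw [Complex.im_sum, Complex.zero_im]
        simp only [Matrix.diag_apply, hY₀im]
        rw [← hHr_sum]
        have h0 : (∑ i, fun c => (v c i i).im) = 0 := by
          funext c; rw [Finset.sum_apply, Pi.zero_apply, ← Complex.im_sum, htr c, Complex.zero_im]
        rw [h0, hHr_zero]
  -- the spikes and the corrected field
  set ψ : (PBond P k → Matrix n n ℂ) → Site P 0 → Matrix n n ℂ := fun v x =>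
    if x = embIter k (iterBlockOf k x) then Λ k (Y₀ v) (iterBlockOf k x) else 0 with hψ
  set R : (PBond P k → Matrix n n ℂ) → PBond P 0 → Matrix n n ℂ := fun v b => Y₀ v b + (ψ v b.tgt - ψ v b.src) with hR
  have hψc : ∀ v (y : Site P k), ψ v (embIter k y) = Λ k (Y₀ v) y := fun v y => by
    simp only [hψ, iterBlockOf_embIter k hk y, if_true]
  have hψ_add : ∀ v w x, ψ (v + w) x = ψ v x + ψ w x := fun v w x => by
    simp only [hψ, hY₀_add]
    split_ifs
    · exact combFamily_add Λ hΛ0 hΛs k (Y₀ v) (Y₀ w) _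
    · rw [add_zero]
  have hψ_smul : ∀ (a : ℝ) v x, ψ (a • v) x = a • ψ v x := fun a v x => by
    simp only [hψ, hY₀_smul]
    split_ifs
    · rw [← Complex.coe_smul, ← combFamily_const_smul Λ hΛ0 hΛs (a : ℂ) k (Y₀ v)]; rfl
    · rw [smul_zero]
  have hψ_su : ∀ v, (∀ c, v c ∈ lieSU n) → ∀ x, ψ v x ∈ lieSU n := fun v hv x => by
    simp only [hψ]
    split_ifs
    · exact combFamily_mem_lieSU' Λ hΛ0 hΛs (hY₀_su v hv) k _
    · exact Submodule.zero_mem _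
  refine ⟨R, fun v c => ?_, fun v w => ?_, fun a v => ?_, fun v hv b => ?_, fun v => ?_⟩
  · -- the identity
    have h1 : Q k (R v) c = Q k (Y₀ v) c + Q k (fun b => ψ v b.tgt - ψ v b.src) c := linFamily_add Q hQ0 hQs k (Y₀ v) _ c
    rw [h1, linFamily_eq_sub_comb Q hQ0 hQs Λ hΛ0 hΛs (Y₀ v) k c, linFamily_grad Q hQ0 hQs (ψ v) k c, hψc, hψc, hstraight]
    abel
  · funext b
    simp only [hR, Pi.add_apply, hψ_add]
    rw [show Y₀ (v + w) b = Y₀ v b + Y₀ w b from congrFun (hY₀_add v w) b]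
    abel
  · funext b
    simp only [hR, Pi.smul_apply, hψ_smul, smul_add, smul_sub]
    rw [show Y₀ (a • v) b = a • Y₀ v b from congrFun (hY₀_smul a v) b]
  · exact Submodule.add_mem _ (hY₀_su v hv b) (Submodule.sub_mem _ (hψ_su v hv _) (hψ_su v hv _))
  -- THE LETTER.  (a) straight part
  have hA : ∑ b, ‖Y₀ v b‖ ^ 2 ≤ Fintype.card n * (3 * (((P.L ^ k : ℕ) : ℝ)) ^ P.d / ((((P.L ^ k : ℕ) : ℝ)) ^ 2 + 2)) * ∑ c, ‖v c‖ ^ 2 := by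
    have h1 : ∑ b, ‖Y₀ v b‖ ^ 2 ≤ ∑ b, ∑ i, ∑ i', ((Hr (fun c => (v c i i').re) b) ^ 2 + (Hr (fun c => (v c i i').im) b) ^ 2) :=
      Finset.sum_le_sum fun b _ => by
        have := norm_sq_le_sum_re_sq_add_im_sq (Y₀ v b)
        simpa only [hY₀re, hY₀im] using this
    have h2 : ∑ b, ∑ i, ∑ i', ((Hr (fun c => (v c i i').re) b) ^ 2 + (Hr (fun c => (v c i i').im) b) ^ 2) =
        ∑ i, ∑ i', (∑ b, (Hr (fun c => (v c i i').re) b) ^ 2 + ∑ b, (Hr (fun c => (v c i i').im) b) ^ 2) := by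
      rw [Finset.sum_comm]
      refine Finset.sum_congr rfl fun i _ => ?_
      rw [Finset.sum_comm]
      refine Finset.sum_congr rfl fun i' _ => ?_
      rw [Finset.sum_add_distrib]
    have h3 : ∀ i i', ∑ b, (Hr (fun c => (v c i i').re) b) ^ 2 + ∑ b, (Hr (fun c => (v c i i').im) b) ^ 2 ≤
        (3 * (((P.L ^ k : ℕ) : ℝ)) ^ P.d / ((((P.L ^ k : ℕ) : ℝ)) ^ 2 + 2)) * ∑ c, ‖v c i i'‖ ^ 2 := fun i i' => by
      have hc : ∑ c, ‖v c i i'‖ ^ 2 = ∑ c, ((v c i i').re ^ 2) + ∑ c, ((v c i i').im ^ 2) := by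
        rw [← Finset.sum_add_distrib]; exact Finset.sum_congr rfl fun c _ => norm_entry_sq_eq (v c) i i'
      rw [hc, mul_add]
      exact add_le_add (hF2 _) (hF2 _)
    have h5 : ∑ i, ∑ i', (3 * (((P.L ^ k : ℕ) : ℝ)) ^ P.d / ((((P.L ^ k : ℕ) : ℝ)) ^ 2 + 2)) * ∑ c, ‖v c i i'‖ ^ 2 =
        (3 * (((P.L ^ k : ℕ) : ℝ)) ^ P.d / ((((P.L ^ k : ℕ) : ℝ)) ^ 2 + 2)) * ∑ c, ∑ i, ∑ i', ‖v c i i'‖ ^ 2 := by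
      simp only [← Finset.mul_sum]
      congr 1
      exact Literature.Probability.Percolation.sum_sum_sum_comm _ _ _ _
    refine h1.trans (h2.le.trans ((Finset.sum_le_sum fun i _ => Finset.sum_le_sum fun i' _ => h3 i i').trans ?_))
    rw [h5, mul_comm (Fintype.card n : ℝ), mul_assoc]
    refine mul_le_mul_of_nonneg_left ?_ (by positivity)
    rw [Finset.mul_sum]
    exact Finset.sum_le_sum fun c _ => sum_norm_entry_sq_le (v c)
  -- (b) the comb functional in `ℓ²`
  have hB : ∑ y : Site P k, ‖Λ k (Y₀ v) y‖ ^ 2 ≤ Fintype.card n * (144 * ((P.d : ℝ) + 2) ^ 2) * ∑ c, ‖v c‖ ^ 2 := by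
    set T : Site P k → ℝ := fun y => ∑ i, ∑ i', ∑ μ : Fin P.d,
      (((G' (fun c => (v c i i').re) ⟨y, μ⟩) ^ 2 + (G' (fun c => (v c i i').re) ⟨y.unshift μ, μ⟩) ^ 2) +
       ((G' (fun c => (v c i i').im) ⟨y, μ⟩) ^ 2 + (G' (fun c => (v c i i').im) ⟨y.unshift μ, μ⟩) ^ 2)) with hT
    have hT0 : ∀ y, 0 ≤ T y := fun y => Finset.sum_nonneg fun _ _ => Finset.sum_nonneg fun _ _ => Finset.sum_nonneg fun _ _ => by positivity
    have hloc : ∀ (y : Site P k) (b : PBond P 0), iterBlockOf k b.src = y → ‖Y₀ v b‖ ^ 2 ≤ 2 * ((((P.L ^ k : ℕ) : ℝ)) ^ P.d)⁻¹ ^ 2 * T y := by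
      intro y b hb
      refine (norm_sq_le_sum_re_sq_add_im_sq (Y₀ v b)).trans ?_
      simp only [hY₀re, hY₀im, hT, Finset.mul_sum]
      refine Finset.sum_le_sum fun i _ => Finset.sum_le_sum fun i' _ => ?_
      set F : Fin P.d → ℝ := fun μ => (2 * ((((P.L ^ k : ℕ) : ℝ)) ^ P.d)⁻¹ ^ 2) * ((((G' (fun c => (v c i i').re) ⟨y, μ⟩) ^ 2 + (G' (fun c => (v c i i').re) ⟨y.unshift μ, μ⟩) ^ 2) +
            ((G' (fun c => (v c i i').im) ⟨y, μ⟩) ^ 2 + (G' (fun c => (v c i i').im) ⟨y.unshift μ, μ⟩) ^ 2))) with hF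
      have hμ : F b.dir ≤ ∑ μ : Fin P.d, F μ := Finset.single_le_sum (f := F) (fun μ _ => by simp only [hF]; positivity) (Finset.mem_univ b.dir)
      refine le_trans ?_ hμ
      simp only [hF]
      have ha := hF3 (fun c => (v c i i').re) b
      have hb' := hF3 (fun c => (v c i i').im) b
      rw [hb] at ha hb'
      linarith
    have hcomb : ∀ y : Site P k, ‖Λ k (Y₀ v) y‖ ^ 2 ≤ (((P.d + 2 : ℕ) : ℝ) * (2 * (P.L : ℝ) ^ k)) ^ 2 * (2 * ((((P.L ^ k : ℕ) : ℝ)) ^ P.d)⁻¹ ^ 2 * T y) := by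
      intro y
      have ha0 : 0 ≤ Real.sqrt (2 * ((((P.L ^ k : ℕ) : ℝ)) ^ P.d)⁻¹ ^ 2 * T y) := Real.sqrt_nonneg _
      have h := norm_combFamily_le_of_local Λ hΛ0 hΛs k hk (Y₀ v) y ha0 fun b hb _ => Real.le_sqrt_of_sq_le (hloc y b hb)
      have hDL : (((P.d + 2) * P.L : ℕ) : ℝ) * (∑ i ∈ Finset.range k, (P.L : ℝ) ^ i) ≤ ((P.d + 2 : ℕ) : ℝ) * (2 * (P.L : ℝ) ^ k) := by
        push_cast; rw [mul_assoc]; exact mul_le_mul_of_nonneg_left (mul_sum_range_pow_le k) (by positivity)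
      have h0 : 0 ≤ ‖Λ k (Y₀ v) y‖ := norm_nonneg _
      have h' : ‖Λ k (Y₀ v) y‖ ≤ (((P.d + 2 : ℕ) : ℝ) * (2 * (P.L : ℝ) ^ k)) * Real.sqrt (2 * ((((P.L ^ k : ℕ) : ℝ)) ^ P.d)⁻¹ ^ 2 * T y) := by
        exact h.trans (mul_le_mul_of_nonneg_right hDL ha0)
      calc ‖Λ k (Y₀ v) y‖ ^ 2 ≤ ((((P.d + 2 : ℕ) : ℝ) * (2 * (P.L : ℝ) ^ k)) * Real.sqrt (2 * ((((P.L ^ k : ℕ) : ℝ)) ^ P.d)⁻¹ ^ 2 * T y)) ^ 2 := pow_le_pow_left₀ h0 h' 2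
        _ = (((P.d + 2 : ℕ) : ℝ) * (2 * (P.L : ℝ) ^ k)) ^ 2 * (2 * ((((P.L ^ k : ℕ) : ℝ)) ^ P.d)⁻¹ ^ 2 * T y) := by
            rw [mul_pow, Real.sq_sqrt (by have := hT0 y; positivity)]
    have hTsum : ∑ y : Site P k, T y ≤ 2 * ((((P.L ^ k : ℕ) : ℝ) ^ 2)⁻¹ * (((((P.L ^ k : ℕ) : ℝ) ^ 2 + 2) / (3 * ((P.L ^ k : ℕ) : ℝ) ^ (P.d + 2))) ^ 2)⁻¹) *
        (Fintype.card n * ∑ c, ‖v c‖ ^ 2) := by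
      have hpair : ∀ w : PBond P k → ℝ, ∑ y : Site P k, ∑ μ : Fin P.d, ((G' w ⟨y, μ⟩) ^ 2 + (G' w ⟨y.unshift μ, μ⟩) ^ 2) = 2 * ∑ c, (G' w c) ^ 2 := by
        intro w
        have h1 : ∑ y : Site P k, ∑ μ : Fin P.d, (G' w ⟨y, μ⟩) ^ 2 = ∑ c, (G' w c) ^ 2 := by
          rw [Summit.QuantumFields.YangMills.Theorems.Prop7FlatCurlCurl.sum_bond_eq_sum_site_dir]
        have h2 : ∑ y : Site P k, ∑ μ : Fin P.d, (G' w ⟨y.unshift μ, μ⟩) ^ 2 = ∑ c, (G' w c) ^ 2 := by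
          rw [Finset.sum_comm]
          have h3 : ∀ μ : Fin P.d, ∑ y : Site P k, (G' w ⟨y.unshift μ, μ⟩) ^ 2 = ∑ y : Site P k, (G' w ⟨y, μ⟩) ^ 2 := fun μ =>
            Equiv.sum_comp (B10StarCount.shiftEquiv μ).symm (fun y => (G' w ⟨y, μ⟩) ^ 2)
          simp only [h3]
          rw [Finset.sum_comm, Summit.QuantumFields.YangMills.Theorems.Prop7FlatCurlCurl.sum_bond_eq_sum_site_dir]
        rw [Finset.sum_congr rfl fun y _ => Finset.sum_add_distrib, Finset.sum_add_distrib, h1, h2]; ring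
      set K : ℝ := 2 * ((((P.L ^ k : ℕ) : ℝ) ^ 2)⁻¹ * (((((P.L ^ k : ℕ) : ℝ) ^ 2 + 2) / (3 * ((P.L ^ k : ℕ) : ℝ) ^ (P.d + 2))) ^ 2)⁻¹) with hK
      have hK0 : 0 ≤ K := by positivity
      have hcompw : ∀ w : PBond P k → ℝ, ∑ y : Site P k, ∑ μ : Fin P.d, ((G' w ⟨y, μ⟩) ^ 2 + (G' w ⟨y.unshift μ, μ⟩) ^ 2) ≤ K * ∑ c, (w c) ^ 2 := fun w => by
        rw [hpair w, hK, mul_assoc]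
        exact mul_le_mul_of_nonneg_left ((hG'le w).trans (le_of_eq (by ring))) (by norm_num)
      have hre : ∑ y : Site P k, T y = ∑ i, ∑ i', (∑ y : Site P k, ∑ μ : Fin P.d, ((G' (fun c => (v c i i').re) ⟨y, μ⟩) ^ 2 + (G' (fun c => (v c i i').re) ⟨y.unshift μ, μ⟩) ^ 2) +
          ∑ y : Site P k, ∑ μ : Fin P.d, ((G' (fun c => (v c i i').im) ⟨y, μ⟩) ^ 2 + (G' (fun c => (v c i i').im) ⟨y.unshift μ, μ⟩) ^ 2)) := by
        simp only [hT]
        rw [Finset.sum_comm]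
        refine Finset.sum_congr rfl fun i _ => ?_
        rw [Finset.sum_comm]
        refine Finset.sum_congr rfl fun i' _ => ?_
        rw [← Finset.sum_add_distrib]
        exact Finset.sum_congr rfl fun y _ => by rw [← Finset.sum_add_distrib]
      rw [hre]
      calc ∑ i, ∑ i', (∑ y : Site P k, ∑ μ : Fin P.d, ((G' (fun c => (v c i i').re) ⟨y, μ⟩) ^ 2 + (G' (fun c => (v c i i').re) ⟨y.unshift μ, μ⟩) ^ 2) +
            ∑ y : Site P k, ∑ μ : Fin P.d, ((G' (fun c => (v c i i').im) ⟨y, μ⟩) ^ 2 + (G' (fun c => (v c i i').im) ⟨y.unshift μ, μ⟩) ^ 2))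
          ≤ ∑ i, ∑ i', (K * ∑ c, ((v c i i').re) ^ 2 + K * ∑ c, ((v c i i').im) ^ 2) :=
            Finset.sum_le_sum fun i _ => Finset.sum_le_sum fun i' _ => add_le_add (hcompw _) (hcompw _)
        _ = K * ∑ c, ∑ i, ∑ i', ‖v c i i'‖ ^ 2 := by
            have e1 : ∀ i i', K * ∑ c, ((v c i i').re) ^ 2 + K * ∑ c, ((v c i i').im) ^ 2 = K * ∑ c, ‖v c i i'‖ ^ 2 := fun i i' => by
              rw [← mul_add, ← Finset.sum_add_distrib]
              congr 1
              exact Finset.sum_congr rfl fun c _ => (norm_entry_sq_eq (v c) i i').symm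
            simp only [e1, ← Finset.mul_sum]
            congr 1
            exact Literature.Probability.Percolation.sum_sum_sum_comm _ _ _ _
        _ ≤ K * (Fintype.card n * ∑ c, ‖v c‖ ^ 2) := by
            refine mul_le_mul_of_nonneg_left ?_ hK0
            rw [Finset.mul_sum]
            exact Finset.sum_le_sum fun c _ => sum_norm_entry_sq_le (v c)
    have hconst : (((P.d + 2 : ℕ) : ℝ) * (2 * (P.L : ℝ) ^ k)) ^ 2 * (2 * ((((P.L ^ k : ℕ) : ℝ)) ^ P.d)⁻¹ ^ 2) *
        (2 * ((((P.L ^ k : ℕ) : ℝ) ^ 2)⁻¹ * (((((P.L ^ k : ℕ) : ℝ) ^ 2 + 2) / (3 * ((P.L ^ k : ℕ) : ℝ) ^ (P.d + 2))) ^ 2)⁻¹)) ≤ 144 * ((P.d : ℝ) + 2) ^ 2 := by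
      have h1 : ∀ M : ℝ, M ≠ 0 → (((P.d + 2 : ℕ) : ℝ) * (2 * M)) ^ 2 * (2 * (M ^ P.d)⁻¹ ^ 2) * (2 * ((M ^ 2)⁻¹ * (((M ^ 2 + 2) / (3 * M ^ (P.d + 2))) ^ 2)⁻¹)) =
          144 * ((P.d : ℝ) + 2) ^ 2 * (M ^ 4 / (M ^ 2 + 2) ^ 2) := fun M hM => by
        push_cast; field_simp; ring
      have h2 : (((P.L ^ k : ℕ) : ℝ)) ^ 4 / ((((P.L ^ k : ℕ) : ℝ)) ^ 2 + 2) ^ 2 ≤ 1 := by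
        rw [div_le_one (by positivity)]; nlinarith [sq_nonneg ((((P.L ^ k : ℕ) : ℝ)) ^ 2)]
      rw [hLk, h1 _ hM']
      calc 144 * ((P.d : ℝ) + 2) ^ 2 * ((((P.L ^ k : ℕ) : ℝ)) ^ 4 / ((((P.L ^ k : ℕ) : ℝ)) ^ 2 + 2) ^ 2) ≤ 144 * ((P.d : ℝ) + 2) ^ 2 * 1 :=
            mul_le_mul_of_nonneg_left h2 (by positivity)
        _ = 144 * ((P.d : ℝ) + 2) ^ 2 := mul_one _
    calc ∑ y : Site P k, ‖Λ k (Y₀ v) y‖ ^ 2 ≤ ∑ y : Site P k, (((P.d + 2 : ℕ) : ℝ) * (2 * (P.L : ℝ) ^ k)) ^ 2 * (2 * ((((P.L ^ k : ℕ) : ℝ)) ^ P.d)⁻¹ ^ 2 * T y) :=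
          Finset.sum_le_sum fun y _ => hcomb y
      _ = (((P.d + 2 : ℕ) : ℝ) * (2 * (P.L : ℝ) ^ k)) ^ 2 * (2 * ((((P.L ^ k : ℕ) : ℝ)) ^ P.d)⁻¹ ^ 2) * ∑ y : Site P k, T y := by
          rw [Finset.mul_sum]; exact Finset.sum_congr rfl fun y _ => by ring
      _ ≤ (((P.d + 2 : ℕ) : ℝ) * (2 * (P.L : ℝ) ^ k)) ^ 2 * (2 * ((((P.L ^ k : ℕ) : ℝ)) ^ P.d)⁻¹ ^ 2) *
            (2 * ((((P.L ^ k : ℕ) : ℝ) ^ 2)⁻¹ * (((((P.L ^ k : ℕ) : ℝ) ^ 2 + 2) / (3 * ((P.L ^ k : ℕ) : ℝ) ^ (P.d + 2))) ^ 2)⁻¹) * (Fintype.card n * ∑ c, ‖v c‖ ^ 2)) :=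
          mul_le_mul_of_nonneg_left hTsum (by positivity)
      _ = ((((P.d + 2 : ℕ) : ℝ) * (2 * (P.L : ℝ) ^ k)) ^ 2 * (2 * ((((P.L ^ k : ℕ) : ℝ)) ^ P.d)⁻¹ ^ 2) *
            (2 * ((((P.L ^ k : ℕ) : ℝ) ^ 2)⁻¹ * (((((P.L ^ k : ℕ) : ℝ) ^ 2 + 2) / (3 * ((P.L ^ k : ℕ) : ℝ) ^ (P.d + 2))) ^ 2)⁻¹))) * (Fintype.card n * ∑ c, ‖v c‖ ^ 2) := by ring
      _ ≤ (144 * ((P.d : ℝ) + 2) ^ 2) * (Fintype.card n * ∑ c, ‖v c‖ ^ 2) := mul_le_mul_of_nonneg_right hconst (by positivity)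
      _ = Fintype.card n * (144 * ((P.d : ℝ) + 2) ^ 2) * ∑ c, ‖v c‖ ^ 2 := by ring
  -- (c) total: spikes cost `4d·Σ_x‖ψ‖² = 4d·Σ_y‖Λ‖²`
  have hspike : ∑ x : Site P 0, ‖ψ v x‖ ^ 2 = ∑ y : Site P k, ‖Λ k (Y₀ v) y‖ ^ 2 := sum_norm_sq_spike_iter_eq hk (Λ k (Y₀ v))
  have hgrad := sum_norm_sq_grad_le (ψ v)
  have hpt2 : ∀ b : PBond P 0, ‖R v b‖ ^ 2 ≤ 2 * ‖Y₀ v b‖ ^ 2 + 2 * ‖ψ v b.tgt - ψ v b.src‖ ^ 2 := fun b => by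
    have h := norm_add_le (Y₀ v b) (ψ v b.tgt - ψ v b.src)
    nlinarith [norm_nonneg (Y₀ v b + (ψ v b.tgt - ψ v b.src)), norm_nonneg (Y₀ v b), norm_nonneg (ψ v b.tgt - ψ v b.src), sq_nonneg (‖Y₀ v b‖ - ‖ψ v b.tgt - ψ v b.src‖)]
  have hd0 : (0 : ℝ) ≤ P.d := Nat.cast_nonneg _
  calc ∑ b, ‖R v b‖ ^ 2 ≤ ∑ b, (2 * ‖Y₀ v b‖ ^ 2 + 2 * ‖ψ v b.tgt - ψ v b.src‖ ^ 2) := Finset.sum_le_sum fun b _ => hpt2 b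
    _ = 2 * ∑ b, ‖Y₀ v b‖ ^ 2 + 2 * ∑ b : PBond P 0, ‖ψ v b.tgt - ψ v b.src‖ ^ 2 := by rw [Finset.sum_add_distrib, Finset.mul_sum, Finset.mul_sum]
    _ ≤ 2 * ∑ b, ‖Y₀ v b‖ ^ 2 + 2 * (4 * P.d * ∑ x : Site P 0, ‖ψ v x‖ ^ 2) := by linarith
    _ = 2 * ∑ b, ‖Y₀ v b‖ ^ 2 + 8 * P.d * ∑ y : Site P k, ‖Λ k (Y₀ v) y‖ ^ 2 := by rw [hspike]; ring
    _ ≤ 2 * (Fintype.card n * (3 * (((P.L ^ k : ℕ) : ℝ)) ^ P.d / ((((P.L ^ k : ℕ) : ℝ)) ^ 2 + 2)) * ∑ c, ‖v c‖ ^ 2) +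
          8 * P.d * (Fintype.card n * (144 * ((P.d : ℝ) + 2) ^ 2) * ∑ c, ‖v c‖ ^ 2) :=
        add_le_add (mul_le_mul_of_nonneg_left hA (by norm_num)) (mul_le_mul_of_nonneg_left hB (by positivity))
    _ = Fintype.card n * (6 * (((P.L ^ k : ℕ) : ℝ)) ^ P.d / ((((P.L ^ k : ℕ) : ℝ)) ^ 2 + 2) + 1152 * P.d * ((P.d : ℝ) + 2) ^ 2) * ∑ c, ‖v c‖ ^ 2 := by ring

end Summit.QuantumFields.YangMills.BalabanUVNodes.N12FlatLinFamilyRightInverseUniform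
end
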